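import Literature.Analysis.FluidPDE.FourierL2Convolution
import Literature.Analysis.FluidPDE.SobolevWholeSpace
import Literature.Analysis.FluidPDE.NSFourierPlancherel
import Literature.Analysis.FluidPDE.CoordDerivatives
import Mathlib.Analysis.Fourier.FourierTransformDeriv
import Mathlib.Analysis.Fourier.Convolution
import HarnessLib

/-!
# Tao's bilinear estimate on the Fourier side: `‖(‖·‖ V) ⋆ₗ W‖₂ ≲ ‖ρV‖₂^{1/2} ‖ρ²V‖₂^{1/2} ‖ρW‖₂`

Second file of the weighted-`L²` Fourier-side construction of the local smooth solution of the
Navier–Stokes system with `H¹`-controlled lifespan (discharge of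
`Literature.Analysis.FluidPDE.tao2011_fourier_local_existence`; Tao 2013, Thm. 5.4 (ii)+(iv)).
The `X¹` contraction in the proof of Tao's Thm. 5.4 (arXiv Thm. 28/31, pp. 16, 18) rests on
the bilinear estimate of his Lemma 2.1 = arXiv Lemma 23 (p. 10),

  `‖∇(u v)‖_{L²_x} ≲ ‖u‖_{L⁶} ‖∇v‖_{L³} + ‖∇u‖_{L³} ‖v‖_{L⁶}`,
  `‖w‖_{L⁶(ℝ³)} ≲ ‖∇w‖_{L²}`,  `‖w‖_{L³} ≤ ‖w‖_{L²}^{1/2} ‖w‖_{L⁶}^{1/2}`,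

i.e. Sobolev embedding `Ḣ¹(ℝ³) ⊂ L⁶(ℝ³)`, Hölder and interpolation. On the Fourier side
(`u = 𝓕 V`, products ↔ convolutions, `∇ ↔ 2πi ξ`, Plancherel) this becomes an estimate for the
**majorant convolution** of `FourierL2Convolution`: with `ρ(ξ) = ‖ξ‖` and `Φ = ‖f‖ₑ`,
`Ψ = ‖g‖ₑ`,

  `‖(ρ Φ) ⋆ₗ Ψ‖_{L²_ξ} ≤ (2π K)^{3/2} ‖ρ Φ‖₂^{1/2} ‖ρ² Φ‖₂^{1/2} ‖ρ Ψ‖₂`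
  (`eLpNorm_lconv_norm_weight_le`, `K` Mathlib's Gagliardo–Nirenberg–Sobolev constant).

Ingredients, each proved here in the form needed:

* `inv_exponents_eq_ofReal`: the exponent bookkeeping (`3⁻¹ + 6⁻¹ = 2⁻¹`, `2⁻¹ + 6⁻¹ = (3/2)⁻¹`);
* `eLpNorm_three_le`: interpolation `‖w‖₃ ≤ ‖w‖₂^{1/2} ‖w‖₆^{1/2}` (Hölder);
* `lintegral_enorm_fderiv_fourier_sq_le`: `‖∇ 𝓕 G‖²_{L²} ≤ 4π² ‖ρ G‖²_{L²}`
  (Mathlib `Real.fderiv_fourier`, the operator norm bounded by the coordinate derivatives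
  `∂ₗ 𝓕 G = 𝓕(-2πi ξₗ G)`, and the tree's Plancherel for `L¹ ∩ L²` functions);
* `eLpNorm_fourier_six_le`: `‖𝓕 G‖_{L⁶} ≤ 2π K ‖ρ G‖_{L²}` (the tree's whole-space
  Gagliardo–Nirenberg–Sobolev inequality `eLpNorm_six_le_eLpNorm_fderiv_two`);
* the convolution theorem `𝓕(F ⋆ G) = 𝓕F · 𝓕G` (Mathlib) and Plancherel to pass from
  `‖(ρΦ) ⋆ₗ Ψ‖_{L²_ξ}` to `‖𝓕F · 𝓕G‖_{L²_x}` with `F = ρ‖f‖`, `G = ‖g‖` (real, non-negative).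

## Mathlib search

`Real.fourier_mul_convolution_eq`, `Real.fderiv_fourier`, `Real.contDiff_fourier`,
`Real.fourier_continuousLinearMap_apply`, `MeasureTheory.eLpNorm_le_eLpNorm_mul_eLpNorm_of_nnnorm`
(Hölder with `HolderTriple`), `MeasureTheory.eLpNorm_enorm_rpow`,
`MeasureTheory.SNormLESNormFDerivOfEqConst`. Tree: `eLpNorm_six_le_eLpNorm_fderiv_two`
(`SobolevWholeSpace`), `eLpNorm_fourierIntegral_eq`, `memLp_two_fourierIntegral`,
`memLp_two_of_bound` (`NSFourierPlancherel`), `sq_opNorm_le_sum_sq_norm_apply_stdVec`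
(`CoordDerivatives`). No Mathlib interpolation inequality between `L^p` norms was found (searched
`eLpNorm_le_eLpNorm_mul_eLpNorm`, `interpolation`).

## References

* T. Tao, Anal. PDE 6 (2013) = arXiv:1108.1165, §2, arXiv Lemma 23 (p. 10) and the proof of
  arXiv Thm. 28 (p. 16). [Tao2011]
* L. C. Evans, *Partial Differential Equations*, 2nd ed., §5.6.1 (GNS). [Evans2010]
-/

noncomputable section

open MeasureTheory Real Set Filter Function Complex FourierTransform VectorFourier
open scoped ENNReal NNReal FourierTransform RealInnerProductSpace
open _root_.Topology

namespace Literature.Analysis.FluidPDE.FourierNS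

/-! ### Exponent bookkeeping and interpolation -/

/-- The inverses of the exponents `2, 3, 6, 3/2` as `ENNReal.ofReal` of real inverses (for the
Hölder exponent bookkeeping `3⁻¹ + 6⁻¹ = 2⁻¹`, `2⁻¹ + 6⁻¹ = (3/2)⁻¹`; the triple `(3, 6, 2)` is
also recorded in `NSSerrinEstimates`, not imported here). [folklore] -/
theorem inv_exponents_eq_ofReal :
    (3 : ℝ≥0∞)⁻¹ = ENNReal.ofReal (3⁻¹) ∧ (6 : ℝ≥0∞)⁻¹ = ENNReal.ofReal (6⁻¹) ∧
      (2 : ℝ≥0∞)⁻¹ = ENNReal.ofReal (2⁻¹) ∧ ((3 : ℝ≥0∞) / 2)⁻¹ = ENNReal.ofReal ((3 / 2)⁻¹) := by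
  refine ⟨?_, ?_, ?_, ?_⟩
  · rw [ENNReal.ofReal_inv_of_pos (by norm_num), ENNReal.ofReal_ofNat]
  · rw [ENNReal.ofReal_inv_of_pos (by norm_num), ENNReal.ofReal_ofNat]
  · rw [ENNReal.ofReal_inv_of_pos (by norm_num), ENNReal.ofReal_ofNat]
  · rw [ENNReal.ofReal_inv_of_pos (by norm_num), ENNReal.ofReal_div_of_pos (by norm_num),
      ENNReal.ofReal_ofNat, ENNReal.ofReal_ofNat]

/-- **Interpolation `‖w‖_{L³} ≤ ‖w‖_{L²}^{1/2} ‖w‖_{L⁶}^{1/2}`** (Hölder for `|w|·|w|` with the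
exponents `(2, 6, 3/2)` and `‖ |w|² ‖_{3/2} = ‖w‖₃²`). [folklore] -/
theorem eLpNorm_three_le {α : Type*} [MeasurableSpace α] (μ : Measure α) {w : α → ℂ}
    (hw : AEStronglyMeasurable w μ) :
    eLpNorm w 3 μ ≤ eLpNorm w 2 μ ^ (1 / 2 : ℝ) * eLpNorm w 6 μ ^ (1 / 2 : ℝ) := by
  haveI : ENNReal.HolderTriple 2 6 (3 / 2) := ⟨by
    obtain ⟨-, h6, h2, h32⟩ := inv_exponents_eq_ofReal
    rw [h6, h2, h32, ← ENNReal.ofReal_add (by norm_num) (by norm_num)]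
    norm_num⟩
  -- Hölder for the product `w · w`
  have hH : eLpNorm (fun x => w x * w x) (3 / 2) μ ≤ eLpNorm w 2 μ * eLpNorm w 6 μ := by
    have h := eLpNorm_le_eLpNorm_mul_eLpNorm_of_nnnorm hw hw (fun a b => a * b) 1
      (Eventually.of_forall fun x => by simp [nnnorm_mul]) (p := 2) (q := 6) (r := 3 / 2)
      (μ := μ)
    simpa using h
  -- `‖ |w|² ‖_{3/2} = ‖w‖₃²`
  have hsq : eLpNorm (fun x => w x * w x) (3 / 2) μ = eLpNorm w 3 μ ^ (2 : ℝ) := by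
    have h1 : eLpNorm (fun x => w x * w x) (3 / 2) μ = eLpNorm (fun x => ‖w x‖ₑ ^ (2 : ℝ)) (3 / 2) μ := by
      refine eLpNorm_congr_enorm_ae (Eventually.of_forall fun x => ?_)
      simp only [enorm_mul]
      rw [show (2 : ℝ) = (2 : ℕ) by norm_num, ENNReal.rpow_natCast, sq, enorm_eq_self]
    rw [h1, eLpNorm_enorm_rpow w (by norm_num : (0 : ℝ) < 2)]
    congr 2
    rw [ENNReal.ofReal_ofNat, ENNReal.div_mul_cancel (by norm_num) (by norm_num)]
  rw [hsq] at hH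
  -- take square roots
  calc eLpNorm w 3 μ = (eLpNorm w 3 μ ^ (2 : ℝ)) ^ (1 / 2 : ℝ) := by
        rw [← ENNReal.rpow_mul]; norm_num
    _ ≤ (eLpNorm w 2 μ * eLpNorm w 6 μ) ^ (1 / 2 : ℝ) := ENNReal.rpow_le_rpow hH (by norm_num)
    _ = _ := ENNReal.mul_rpow_of_nonneg _ _ (by norm_num)

/-! ### `‖∇ 𝓕 G‖_{L²} ≤ 2π ‖ρ G‖_{L²}` and `‖𝓕 G‖_{L⁶} ≤ 2π K ‖ρ G‖_{L²}` -/

section Sobolev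

variable {ι : Type*} [Fintype ι]

/-- The coordinate multiplier `-2πi ξₗ G` is integrable when `ρ G ∈ L¹`. [folklore] -/
theorem integrable_coordMul {G : EuclideanSpace ℝ ι → ℂ} (hGm : AEStronglyMeasurable G volume)
    (hG1 : Integrable (fun ξ : EuclideanSpace ℝ ι => ‖ξ‖ * ‖G ξ‖)) (l : ι) :
    Integrable (fun ξ : EuclideanSpace ℝ ι => (-(2 * π * I) * ((ξ l : ℝ) : ℂ)) * G ξ) := by
  refine ((hG1.const_mul (2 * π)).mono' ?_ (Eventually.of_forall fun ξ => ?_))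
  · exact ((Continuous.aestronglyMeasurable (by fun_prop)).mul hGm)
  · rw [norm_mul, norm_mul, norm_neg, norm_mul, norm_mul, Complex.norm_two, Complex.norm_real,
      Complex.norm_I, mul_one, Real.norm_eq_abs, abs_of_pos Real.pi_pos, Complex.norm_real,
      Real.norm_eq_abs]
    calc 2 * π * |ξ l| * ‖G ξ‖ ≤ 2 * π * ‖ξ‖ * ‖G ξ‖ := by
          gcongr; exact abs_apply_le_norm ξ l
      _ = 2 * π * (‖ξ‖ * ‖G ξ‖) := by ring

/-- Pointwise size of the coordinate multiplier: `‖-2πi ξₗ G(ξ)‖ₑ ≤ 2π ‖ξ‖ ‖G ξ‖ₑ`. [folklore] -/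
theorem enorm_coordMul_le (G : EuclideanSpace ℝ ι → ℂ) (l : ι) (ξ : EuclideanSpace ℝ ι) :
    ‖(-(2 * π * I) * ((ξ l : ℝ) : ℂ)) * G ξ‖ₑ ≤
      ENNReal.ofReal (2 * π) * (ENNReal.ofReal ‖ξ‖ * ‖G ξ‖ₑ) := by
  rw [enorm_mul, ← mul_assoc]
  gcongr
  rw [← ofReal_norm, norm_mul, norm_neg, norm_mul, norm_mul, Complex.norm_two, Complex.norm_real,
    Complex.norm_I, mul_one, Real.norm_eq_abs, abs_of_pos Real.pi_pos, Complex.norm_real,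
    Real.norm_eq_abs, ← ENNReal.ofReal_mul (by positivity)]
  exact ENNReal.ofReal_le_ofReal (by gcongr; exact abs_apply_le_norm ξ l)

/-- The sum of squares of the coordinate multipliers: `∑ₗ ‖-2πi ξₗ G(ξ)‖ₑ² = 4π² ‖ξ‖² ‖G ξ‖ₑ²`,
as the inequality `≤ (2π)² (ρ ‖G‖ₑ)²` that is used. [folklore] -/
theorem sum_enorm_coordMul_sq_eq (G : EuclideanSpace ℝ ι → ℂ) (ξ : EuclideanSpace ℝ ι) :
    ∑ l, ‖(-(2 * π * I) * ((ξ l : ℝ) : ℂ)) * G ξ‖ₑ ^ 2 =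
      ENNReal.ofReal ((2 * π) ^ 2) * (ENNReal.ofReal ‖ξ‖ * ‖G ξ‖ₑ) ^ 2 := by
  have hterm : ∀ l, ‖(-(2 * π * I) * ((ξ l : ℝ) : ℂ)) * G ξ‖ₑ ^ 2 =
      ENNReal.ofReal ((2 * π) ^ 2 * (ξ l) ^ 2) * ‖G ξ‖ₑ ^ 2 := by
    intro l
    rw [enorm_mul, mul_pow, ← ofReal_norm, norm_mul, norm_neg, norm_mul, norm_mul,
      Complex.norm_two, Complex.norm_real, Complex.norm_I, mul_one, Real.norm_eq_abs,
      abs_of_pos Real.pi_pos, Complex.norm_real, Real.norm_eq_abs,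
      ← ENNReal.ofReal_pow (by positivity), mul_pow, sq_abs]
  simp_rw [hterm]
  rw [← Finset.sum_mul, ← ENNReal.ofReal_sum_of_nonneg (fun l _ => by positivity),
    ← Finset.mul_sum, sum_sq_eq_norm_sq, ENNReal.ofReal_mul (by positivity), mul_assoc]
  congr 1
  rw [mul_pow, ENNReal.ofReal_pow (norm_nonneg _)]

/-- **`‖∇ 𝓕 G‖²_{L²} ≤ (2π)² ‖ρ G‖²_{L²}`**: for `G ∈ L¹` with `ρ G ∈ L¹ ∩ L²` (`ρ = ‖·‖`),
`∫ ‖D(𝓕 G)(x)‖² dx ≤ (2π)² ∫ ‖ξ‖² ‖G ξ‖² dξ` — the operator norm of `D(𝓕 G)(x)` is bounded by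
the Euclidean norm of the coordinate derivatives `∂ₗ 𝓕 G = 𝓕(-2πi ξₗ G)` (Mathlib
`Real.fderiv_fourier`), and Plancherel applies to each `-2πi ξₗ G ∈ L¹ ∩ L²`. [folklore] -/
theorem lintegral_enorm_fderiv_fourier_sq_le {G : EuclideanSpace ℝ ι → ℂ} (hG : Integrable G)
    (hG1 : Integrable (fun ξ : EuclideanSpace ℝ ι => ‖ξ‖ * ‖G ξ‖))
    (hG2 : ∫⁻ ξ : EuclideanSpace ℝ ι, (ENNReal.ofReal ‖ξ‖ * ‖G ξ‖ₑ) ^ 2 < ⊤) :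
    ∫⁻ x, ‖fderiv ℝ (𝓕 G) x‖ₑ ^ 2 ≤
      ENNReal.ofReal ((2 * π) ^ 2) * ∫⁻ ξ : EuclideanSpace ℝ ι, (ENNReal.ofReal ‖ξ‖ * ‖G ξ‖ₑ) ^ 2 := by
  classical
  set m : ι → EuclideanSpace ℝ ι → ℂ := fun l ξ => (-(2 * π * I) * ((ξ l : ℝ) : ℂ)) * G ξ with hm
  have hmi : ∀ l, Integrable (m l) := fun l => integrable_coordMul hG.1 hG1 l
  have hm2 : ∀ l, MemLp (m l) 2 volume := by
    intro l
    refine ⟨(hmi l).1, ?_⟩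
    rw [← lintegral_enorm_sq_rpow_half_eq_eLpNorm]
    refine ENNReal.rpow_lt_top_of_nonneg (by norm_num) (ne_of_lt (lt_of_le_of_lt ?_
      (ENNReal.mul_lt_top (ENNReal.ofReal_lt_top (r := (2 * π) ^ 2)) hG2)))
    calc ∫⁻ ξ, ‖m l ξ‖ₑ ^ 2 ≤ ∫⁻ ξ : EuclideanSpace ℝ ι,
        (ENNReal.ofReal (2 * π) * (ENNReal.ofReal ‖ξ‖ * ‖G ξ‖ₑ)) ^ 2 :=
          lintegral_mono fun ξ => pow_le_pow_left' (enorm_coordMul_le G l ξ) 2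
      _ = ENNReal.ofReal ((2 * π) ^ 2) * ∫⁻ ξ : EuclideanSpace ℝ ι,
          (ENNReal.ofReal ‖ξ‖ * ‖G ξ‖ₑ) ^ 2 := by
          rw [← lintegral_const_mul' _ _ ENNReal.ofReal_ne_top]
          refine lintegral_congr fun ξ => ?_
          rw [mul_pow, ENNReal.ofReal_pow (by positivity)]
  -- the coordinate derivatives
  have hderiv : ∀ x (l : ι), fderiv ℝ (𝓕 G) x (stdVec l) = 𝓕 (m l) x := by
    intro x l
    have hSI : Integrable (fourierSMulRight (innerSL ℝ) G) := by
      refine (hG1.const_mul (2 * π * ‖(innerSL ℝ : EuclideanSpace ℝ ι →L[ℝ]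
        EuclideanSpace ℝ ι →L[ℝ] ℝ)‖)).mono' (hG.1.fourierSMulRight)
        (Eventually.of_forall fun ξ => ?_)
      exact (norm_fourierSMulRight_le _ G ξ).trans (le_of_eq (by ring))
    rw [Real.fderiv_fourier hG hG1, Real.fourier_continuousLinearMap_apply hSI]
    have hfun : (fun ξ : EuclideanSpace ℝ ι => fourierSMulRight (innerSL ℝ) G ξ (stdVec l)) = m l := by
      funext ξ
      change -(2 * π * I) • ((⟪ξ, stdVec l⟫ : ℝ) • G ξ) = m l ξ
      rw [Complex.real_smul, smul_eq_mul, hm]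
      simp only
      rw [show (⟪ξ, stdVec l⟫ : ℝ) = ξ l by
        rw [stdVec, EuclideanSpace.inner_single_right]; simp]
      ring
    rw [hfun]
  -- pointwise: operator norm ≤ Euclidean norm of the coordinate derivatives
  have hpt : ∀ x, ‖fderiv ℝ (𝓕 G) x‖ₑ ^ 2 ≤ ∑ l, ‖𝓕 (m l) x‖ₑ ^ 2 := by
    intro x
    have h := sq_opNorm_le_sum_sq_norm_apply_stdVec (fderiv ℝ (𝓕 G) x)
    simp_rw [hderiv x] at h
    calc ‖fderiv ℝ (𝓕 G) x‖ₑ ^ 2 = ENNReal.ofReal (‖fderiv ℝ (𝓕 G) x‖ ^ 2) := by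
          rw [ENNReal.ofReal_pow (norm_nonneg _), ofReal_norm]
      _ ≤ ENNReal.ofReal (∑ l, ‖𝓕 (m l) x‖ ^ 2) := ENNReal.ofReal_le_ofReal h
      _ = ∑ l, ‖𝓕 (m l) x‖ₑ ^ 2 := by
          rw [ENNReal.ofReal_sum_of_nonneg (fun l _ => sq_nonneg _)]
          refine Finset.sum_congr rfl fun l _ => ?_
          rw [ENNReal.ofReal_pow (norm_nonneg _), ofReal_norm]
  -- integrate, Plancherel termwise
  calc ∫⁻ x, ‖fderiv ℝ (𝓕 G) x‖ₑ ^ 2 ≤ ∫⁻ x, ∑ l, ‖𝓕 (m l) x‖ₑ ^ 2 := lintegral_mono hpt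
    _ = ∑ l, ∫⁻ x, ‖𝓕 (m l) x‖ₑ ^ 2 :=
        lintegral_finsetSum' _ fun l _ =>
          ((memLp_two_fourierIntegral (hmi l) (hm2 l)).1.enorm.pow_const 2)
    _ = ∑ l, ∫⁻ ξ, ‖m l ξ‖ₑ ^ 2 := by
        refine Finset.sum_congr rfl fun l _ => ?_
        rw [lintegral_enorm_sq_eq_eLpNorm_sq, lintegral_enorm_sq_eq_eLpNorm_sq,
          eLpNorm_fourierIntegral_eq (hmi l) (hm2 l)]
    _ = ∫⁻ ξ, ∑ l, ‖m l ξ‖ₑ ^ 2 :=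
        (lintegral_finsetSum' _ fun l _ => (hmi l).1.enorm.pow_const 2).symm
    _ = ENNReal.ofReal ((2 * π) ^ 2) * ∫⁻ ξ : EuclideanSpace ℝ ι,
          (ENNReal.ofReal ‖ξ‖ * ‖G ξ‖ₑ) ^ 2 := by
        rw [← lintegral_const_mul' _ _ ENNReal.ofReal_ne_top]
        exact lintegral_congr fun ξ => sum_enorm_coordMul_sq_eq G ξ

/-- `eLpNorm` form of `lintegral_enorm_fderiv_fourier_sq_le`:
`‖∇ 𝓕 G‖_{L²} ≤ 2π ‖ρ G‖_{L²}`. [folklore] -/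
theorem eLpNorm_fderiv_fourier_le {G : EuclideanSpace ℝ ι → ℂ} (hG : Integrable G)
    (hG1 : Integrable (fun ξ : EuclideanSpace ℝ ι => ‖ξ‖ * ‖G ξ‖))
    (hG2 : ∫⁻ ξ : EuclideanSpace ℝ ι, (ENNReal.ofReal ‖ξ‖ * ‖G ξ‖ₑ) ^ 2 < ⊤) :
    eLpNorm (fderiv ℝ (𝓕 G)) 2 volume ≤
      ENNReal.ofReal (2 * π) *
        eLpNorm (fun ξ : EuclideanSpace ℝ ι => ENNReal.ofReal ‖ξ‖ * ‖G ξ‖ₑ) 2 volume := by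
  have h := lintegral_enorm_fderiv_fourier_sq_le hG hG1 hG2
  rw [← lintegral_enorm_sq_rpow_half_eq_eLpNorm, ← lintegral_sq_rpow_half_eq_eLpNorm]
  calc (∫⁻ x, ‖fderiv ℝ (𝓕 G) x‖ₑ ^ 2) ^ (1 / 2 : ℝ)
      ≤ (ENNReal.ofReal ((2 * π) ^ 2) * ∫⁻ ξ : EuclideanSpace ℝ ι,
          (ENNReal.ofReal ‖ξ‖ * ‖G ξ‖ₑ) ^ 2) ^ (1 / 2 : ℝ) := ENNReal.rpow_le_rpow h (by norm_num)
    _ = _ := by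
        rw [ENNReal.mul_rpow_of_nonneg _ _ (by norm_num), ENNReal.ofReal_pow (by positivity),
          ← ENNReal.rpow_natCast, ← ENNReal.rpow_mul]
        norm_num

end Sobolev

/-! ### Dimension three: `‖𝓕 G‖₆ ≤ 2πK ‖ρG‖₂` and the bilinear estimate -/

section Three

variable {f g G : EuclideanSpace ℝ (Fin 3) → ℂ}

/-- **`‖𝓕 G‖_{L⁶(ℝ³)} ≤ K · 2π ‖ρ G‖_{L²}`** (`K` Mathlib's Gagliardo–Nirenberg–Sobolev constant for
`p = 2` on `ℝ³`): the Fourier-side form of the Sobolev embedding `Ḣ¹(ℝ³) ⊂ L⁶(ℝ³)`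
(Tao 2013, §2; Evans §5.6.1), from the tree's whole-space GNS inequality for the `C¹ ∩ L²`
function `𝓕 G` and `eLpNorm_fderiv_fourier_le`. [cite: Evans2010, §5.6.1 Thm. 1–2] -/
theorem eLpNorm_fourier_six_le (hG : Integrable G)
    (hG1 : Integrable (fun ξ : EuclideanSpace ℝ (Fin 3) => ‖ξ‖ * ‖G ξ‖)) (hG2 : MemLp G 2 volume)
    (hρG : ∫⁻ ξ : EuclideanSpace ℝ (Fin 3), (ENNReal.ofReal ‖ξ‖ * ‖G ξ‖ₑ) ^ 2 < ⊤) :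
    eLpNorm (𝓕 G) 6 volume ≤
      SNormLESNormFDerivOfEqConst ℂ (volume : Measure (EuclideanSpace ℝ (Fin 3))) 2 *
        (ENNReal.ofReal (2 * π) *
          eLpNorm (fun ξ : EuclideanSpace ℝ (Fin 3) => ENNReal.ofReal ‖ξ‖ * ‖G ξ‖ₑ) 2 volume) := by
  have hC1 : ContDiff ℝ 1 (𝓕 G) := by
    refine Real.contDiff_fourier (N := ((1 : ℕ) : ℕ∞)) fun n hn => ?_
    have hn' : n ≤ 1 := by exact_mod_cast hn
    interval_cases n
    · simpa using hG.norm
    · simpa using hG1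
  have hL2 : eLpNorm (𝓕 G) 2 volume < ⊤ := (memLp_two_fourierIntegral hG hG2).eLpNorm_lt_top
  have h := eLpNorm_six_le_eLpNorm_fderiv_two (F := ℂ) volume finrank_euclideanSpace_fin hC1 hL2
  exact h.trans (by gcongr; exact eLpNorm_fderiv_fourier_le hG hG1 hρG)

/-- The real non-negative majorant `η ↦ (‖η‖ ‖f η‖ : ℂ)` and its basic properties: norm,
measurability. [folklore] -/
theorem norm_ofReal_mul_norm (η : EuclideanSpace ℝ (Fin 3)) :
    ‖(((‖η‖ * ‖f η‖ : ℝ)) : ℂ)‖ = ‖η‖ * ‖f η‖ := by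
  rw [Complex.norm_real, Real.norm_eq_abs, abs_of_nonneg (by positivity)]

/-- **The bilinear estimate on the Fourier side (Tao's Lemma 2.1, arXiv Lemma 23, in the form
`‖∇(uv)‖₂ ≲ ‖∇u‖_{L³}‖v‖_{L⁶} ≲ ‖∇u‖₂^{1/2}‖∇²u‖₂^{1/2}‖∇v‖₂`).** For measurable
`f, g : ℝ³ → ℂ` with `ρf, ρ²f ∈ L¹`, `g, ρg ∈ L¹ ∩ L²` and the finiteness of the weighted square
norms on the right (`ρ = ‖·‖`),

  `‖(ρ‖f‖ₑ) ⋆ₗ ‖g‖ₑ‖_{L²_ξ} ≤ (K·2π)^{3/2} ‖ρ f‖₂^{1/2} ‖ρ² f‖₂^{1/2} ‖ρ g‖₂`.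

Proof: with the real non-negative `F = ρ‖f‖`, `G = ‖g‖` one has
`((ρ‖f‖ₑ) ⋆ₗ ‖g‖ₑ)(ξ) = ‖(F ⋆ G)(ξ)‖` pointwise; Plancherel and the convolution theorem give
`‖F ⋆ G‖_{L²_ξ} = ‖𝓕F · 𝓕G‖_{L²_x} ≤ ‖𝓕F‖₃ ‖𝓕G‖₆`; then `‖𝓕G‖₆ ≤ 2πK‖ρG‖₂`
(`eLpNorm_fourier_six_le`) and `‖𝓕F‖₃ ≤ ‖𝓕F‖₂^{1/2}‖𝓕F‖₆^{1/2} ≤ ‖F‖₂^{1/2}(2πK‖ρF‖₂)^{1/2}`.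
[cite: Tao2011, Lemma 2.1 (arXiv Lemma 23)] -/
theorem eLpNorm_lconv_norm_weight_le (hfm : AEStronglyMeasurable f volume)
    (hgm : AEStronglyMeasurable g volume)
    (hf1 : Integrable (fun η : EuclideanSpace ℝ (Fin 3) => ‖η‖ * ‖f η‖))
    (hf2 : Integrable (fun η : EuclideanSpace ℝ (Fin 3) => ‖η‖ ^ 2 * ‖f η‖))
    (hfL2 : ∫⁻ η : EuclideanSpace ℝ (Fin 3), (ENNReal.ofReal ‖η‖ * ‖f η‖ₑ) ^ 2 < ⊤)
    (hf2L2 : ∫⁻ η : EuclideanSpace ℝ (Fin 3), (ENNReal.ofReal (‖η‖ ^ 2) * ‖f η‖ₑ) ^ 2 < ⊤)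
    (hg0 : Integrable g) (hg1 : Integrable (fun η : EuclideanSpace ℝ (Fin 3) => ‖η‖ * ‖g η‖))
    (hgL2 : MemLp g 2 volume)
    (hg1L2 : ∫⁻ η : EuclideanSpace ℝ (Fin 3), (ENNReal.ofReal ‖η‖ * ‖g η‖ₑ) ^ 2 < ⊤) :
    eLpNorm (fun ξ => ((fun η => ENNReal.ofReal ‖η‖ * ‖f η‖ₑ) ⋆ₗ (fun η => ‖g η‖ₑ)) ξ) 2 volume ≤
      (SNormLESNormFDerivOfEqConst ℂ (volume : Measure (EuclideanSpace ℝ (Fin 3))) 2 *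
          ENNReal.ofReal (2 * π)) ^ (3 / 2 : ℝ) *
        eLpNorm (fun η : EuclideanSpace ℝ (Fin 3) => ENNReal.ofReal ‖η‖ * ‖f η‖ₑ) 2 volume
          ^ (1 / 2 : ℝ) *
        eLpNorm (fun η : EuclideanSpace ℝ (Fin 3) => ENNReal.ofReal (‖η‖ ^ 2) * ‖f η‖ₑ) 2 volume
          ^ (1 / 2 : ℝ) *
        eLpNorm (fun η : EuclideanSpace ℝ (Fin 3) => ENNReal.ofReal ‖η‖ * ‖g η‖ₑ) 2 volume := by
  -- the real non-negative factors
  set F : EuclideanSpace ℝ (Fin 3) → ℂ := fun η => ((‖η‖ * ‖f η‖ : ℝ) : ℂ) with hF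
  set Gr : EuclideanSpace ℝ (Fin 3) → ℂ := fun η => ((‖g η‖ : ℝ) : ℂ) with hGr
  set K : ℝ≥0 := SNormLESNormFDerivOfEqConst ℂ (volume : Measure (EuclideanSpace ℝ (Fin 3))) 2
    with hK
  have hFn : ∀ η, ‖F η‖ = ‖η‖ * ‖f η‖ := fun η => norm_ofReal_mul_norm η
  have hGn : ∀ η, ‖Gr η‖ = ‖g η‖ := fun η => by
    rw [hGr]; simp only [Complex.norm_real, norm_norm]
  have hFe : ∀ η, ‖F η‖ₑ = ENNReal.ofReal ‖η‖ * ‖f η‖ₑ := fun η => by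
    rw [← ofReal_norm, hFn, ENNReal.ofReal_mul (norm_nonneg _), ofReal_norm (f η)]
  have hGe : ∀ η, ‖Gr η‖ₑ = ‖g η‖ₑ := fun η => by
    rw [← ofReal_norm, hGn, ofReal_norm (g η)]
  have hFm : AEStronglyMeasurable F volume :=
    Complex.continuous_ofReal.comp_aestronglyMeasurable (continuous_norm.aestronglyMeasurable.mul
      hfm.norm)
  have hGm : AEStronglyMeasurable Gr volume :=
    Complex.continuous_ofReal.comp_aestronglyMeasurable hgm.norm
  have hFi : Integrable F := ⟨hFm, by
    refine (hasFiniteIntegral_congr' (Eventually.of_forall fun η => ?_)).1 hf1.2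
    rw [hFn, Real.norm_eq_abs, abs_of_nonneg (by positivity)]⟩
  have hGi : Integrable Gr := ⟨hGm, by
    refine (hasFiniteIntegral_congr' (Eventually.of_forall fun η => ?_)).1 hg0.2
    rw [hGn]⟩
  have hF1 : Integrable (fun η : EuclideanSpace ℝ (Fin 3) => ‖η‖ * ‖F η‖) := by
    refine hf2.congr (Eventually.of_forall fun η => ?_)
    simp only [hFn]; ring
  have hG1 : Integrable (fun η : EuclideanSpace ℝ (Fin 3) => ‖η‖ * ‖Gr η‖) := by
    refine hg1.congr (Eventually.of_forall fun η => ?_)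
    simp only [hGn]
  have hFL2' : ∫⁻ η, ‖F η‖ₑ ^ 2 < ⊤ := by simpa only [hFe] using hfL2
  have hF2 : MemLp F 2 volume := ⟨hFm, by
    rw [← lintegral_enorm_sq_rpow_half_eq_eLpNorm]
    exact ENNReal.rpow_lt_top_of_nonneg (by norm_num) hFL2'.ne⟩
  have hG2 : MemLp Gr 2 volume := ⟨hGm, by
    rw [← lintegral_enorm_sq_rpow_half_eq_eLpNorm]
    simp only [hGe]
    rw [lintegral_enorm_sq_rpow_half_eq_eLpNorm]
    exact hgL2.eLpNorm_lt_top⟩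
  have hρF : ∫⁻ η : EuclideanSpace ℝ (Fin 3), (ENNReal.ofReal ‖η‖ * ‖F η‖ₑ) ^ 2 < ⊤ := by
    refine lt_of_le_of_lt (le_of_eq (lintegral_congr fun η => ?_)) hf2L2
    rw [hFe, ← mul_assoc, ← ENNReal.ofReal_mul (norm_nonneg _), ← sq]
  have hρG : ∫⁻ η : EuclideanSpace ℝ (Fin 3), (ENNReal.ofReal ‖η‖ * ‖Gr η‖ₑ) ^ 2 < ⊤ := by
    simpa only [hGe] using hg1L2
  -- Step 1: the majorant convolution is the norm of `F ⋆ Gr`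
  have hconv : ∀ ξ, ((fun η => ENNReal.ofReal ‖η‖ * ‖f η‖ₑ) ⋆ₗ (fun η => ‖g η‖ₑ)) ξ =
      ‖fconv F Gr ξ‖ₑ := by
    intro ξ
    have hint : Integrable (fun η => F η * Gr (ξ - η)) volume :=
      integrable_fconv_integrand hF2 hG2 ξ
    have hreal : ∀ η, F η * Gr (ξ - η) = ((‖η‖ * ‖f η‖ * ‖g (ξ - η)‖ : ℝ) : ℂ) := fun η => by
      rw [hF, hGr]; push_cast; ring
    have hintR : Integrable (fun η => ‖η‖ * ‖f η‖ * ‖g (ξ - η)‖) volume := by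
      refine hint.norm.congr (Eventually.of_forall fun η => ?_)
      change ‖F η * Gr (ξ - η)‖ = _
      rw [hreal, Complex.norm_real, Real.norm_eq_abs, abs_of_nonneg (by positivity)]
    rw [fconv_apply, show (fun η => F η * Gr (ξ - η)) =
        fun η => ((‖η‖ * ‖f η‖ * ‖g (ξ - η)‖ : ℝ) : ℂ) from funext hreal,
      integral_complex_ofReal, ← ofReal_norm, Complex.norm_real, Real.norm_eq_abs,
      abs_of_nonneg (integral_nonneg fun η => by positivity),
      ofReal_integral_eq_lintegral_ofReal hintR (Eventually.of_forall fun η => by positivity),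
      lconv_apply]
    refine lintegral_congr fun η => ?_
    rw [ENNReal.ofReal_mul (by positivity), ENNReal.ofReal_mul (norm_nonneg _)]
    simp only [ofReal_norm]
  -- Step 2–3: Plancherel for `F ⋆ Gr ∈ L¹ ∩ L²`
  have hcI : Integrable (fconv F Gr) := integrable_fconv hFi hGi
  have hcB : ∀ ξ, ‖fconv F Gr ξ‖ ≤ (eLpNorm F 2 volume * eLpNorm Gr 2 volume).toReal := by
    intro ξ
    rw [← toReal_enorm]
    exact ENNReal.toReal_mono (ENNReal.mul_ne_top hF2.eLpNorm_ne_top hG2.eLpNorm_ne_top)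
      (enorm_fconv_le hFm hGm ξ)
  have hc2 : MemLp (fconv F Gr) 2 volume := memLp_two_of_bound hcI hcB
  have hPl : eLpNorm (fun ξ => ((fun η => ENNReal.ofReal ‖η‖ * ‖f η‖ₑ) ⋆ₗ (fun η => ‖g η‖ₑ)) ξ)
      2 volume = eLpNorm (fun x => 𝓕 F x * 𝓕 Gr x) 2 volume := by
    calc _ = eLpNorm (fun ξ => ‖fconv F Gr ξ‖ₑ) 2 volume := by simp_rw [hconv]
      _ = eLpNorm (fconv F Gr) 2 volume := eLpNorm_enorm _
      _ = eLpNorm (𝓕 (fconv F Gr)) 2 volume := (eLpNorm_fourierIntegral_eq hcI hc2).symm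
      _ = eLpNorm (fun x => 𝓕 F x * 𝓕 Gr x) 2 volume := by
          congr 1; funext x; exact Real.fourier_mul_convolution_eq hFi hGi x
  -- Step 4: Hölder `‖𝓕F · 𝓕Gr‖₂ ≤ ‖𝓕F‖₃ ‖𝓕Gr‖₆`
  haveI : ENNReal.HolderTriple 3 6 2 := ⟨by
    obtain ⟨h3, h6, h2, -⟩ := inv_exponents_eq_ofReal
    rw [h3, h6, h2, ← ENNReal.ofReal_add (by norm_num) (by norm_num)]
    norm_num⟩
  have hFF : AEStronglyMeasurable (𝓕 F) volume :=
    (continuous_fourierIntegral hFi).aestronglyMeasurable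
  have hFG : AEStronglyMeasurable (𝓕 Gr) volume :=
    (continuous_fourierIntegral hGi).aestronglyMeasurable
  have hH : eLpNorm (fun x => 𝓕 F x * 𝓕 Gr x) 2 volume ≤
      eLpNorm (𝓕 F) 3 volume * eLpNorm (𝓕 Gr) 6 volume := by
    have h := eLpNorm_le_eLpNorm_mul_eLpNorm_of_nnnorm hFF hFG (fun a b => a * b) 1
      (Eventually.of_forall fun x => by simp [nnnorm_mul]) (p := 3) (q := 6) (r := 2)
      (μ := volume)
    simpa using h
  -- Step 5–6: Sobolev for `𝓕 Gr` and interpolation + Sobolev for `𝓕 F`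
  have h6G := eLpNorm_fourier_six_le hGi hG1 hG2 hρG
  have h6F := eLpNorm_fourier_six_le hFi hF1 hF2 hρF
  have h3F : eLpNorm (𝓕 F) 3 volume ≤
      eLpNorm F 2 volume ^ (1 / 2 : ℝ) * (K * (ENNReal.ofReal (2 * π) *
        eLpNorm (fun ξ : EuclideanSpace ℝ (Fin 3) => ENNReal.ofReal ‖ξ‖ * ‖F ξ‖ₑ) 2 volume))
          ^ (1 / 2 : ℝ) := by
    refine (eLpNorm_three_le volume hFF).trans ?_
    rw [eLpNorm_fourierIntegral_eq hFi hF2]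
    gcongr
  -- the weighted norms of `F`, `Gr` are those of `f`, `g`
  have eF : eLpNorm F 2 volume =
      eLpNorm (fun η : EuclideanSpace ℝ (Fin 3) => ENNReal.ofReal ‖η‖ * ‖f η‖ₑ) 2 volume := by
    rw [← eLpNorm_enorm F]; simp_rw [hFe]
  have eρF : eLpNorm (fun ξ : EuclideanSpace ℝ (Fin 3) => ENNReal.ofReal ‖ξ‖ * ‖F ξ‖ₑ) 2 volume =
      eLpNorm (fun η : EuclideanSpace ℝ (Fin 3) => ENNReal.ofReal (‖η‖ ^ 2) * ‖f η‖ₑ) 2 volume := by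
    congr 1; funext η
    rw [hFe, ← mul_assoc, ← ENNReal.ofReal_mul (norm_nonneg _), ← sq]
  have eρG : eLpNorm (fun ξ : EuclideanSpace ℝ (Fin 3) => ENNReal.ofReal ‖ξ‖ * ‖Gr ξ‖ₑ) 2 volume =
      eLpNorm (fun η : EuclideanSpace ℝ (Fin 3) => ENNReal.ofReal ‖η‖ * ‖g η‖ₑ) 2 volume := by
    simp_rw [hGe]
  rw [eF, eρF] at h3F
  rw [eρG] at h6G
  -- assemble
  set A := eLpNorm (fun η : EuclideanSpace ℝ (Fin 3) => ENNReal.ofReal ‖η‖ * ‖f η‖ₑ) 2 volume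
  set B := eLpNorm (fun η : EuclideanSpace ℝ (Fin 3) => ENNReal.ofReal (‖η‖ ^ 2) * ‖f η‖ₑ) 2 volume
  set C := eLpNorm (fun η : EuclideanSpace ℝ (Fin 3) => ENNReal.ofReal ‖η‖ * ‖g η‖ₑ) 2 volume
  set L : ℝ≥0∞ := (K : ℝ≥0∞) * ENNReal.ofReal (2 * π) with hL
  calc _ = eLpNorm (fun x => 𝓕 F x * 𝓕 Gr x) 2 volume := hPl
    _ ≤ eLpNorm (𝓕 F) 3 volume * eLpNorm (𝓕 Gr) 6 volume := hH
    _ ≤ (A ^ (1 / 2 : ℝ) * ((K : ℝ≥0∞) * (ENNReal.ofReal (2 * π) * B)) ^ (1 / 2 : ℝ)) *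
          ((K : ℝ≥0∞) * (ENNReal.ofReal (2 * π) * C)) := by gcongr
    _ = L ^ (3 / 2 : ℝ) * A ^ (1 / 2 : ℝ) * B ^ (1 / 2 : ℝ) * C := by
        rw [show (K : ℝ≥0∞) * (ENNReal.ofReal (2 * π) * B) = L * B by rw [hL, mul_assoc],
          show (K : ℝ≥0∞) * (ENNReal.ofReal (2 * π) * C) = L * C by rw [hL, mul_assoc],
          ENNReal.mul_rpow_of_nonneg _ _ (by norm_num : (0 : ℝ) ≤ 1 / 2),
          show (3 / 2 : ℝ) = 1 / 2 + 1 by norm_num, ENNReal.rpow_add_of_nonneg _ _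
            (by norm_num) (by norm_num), ENNReal.rpow_one]
        ring

end Three

end Literature.Analysis.FluidPDE.FourierNS

end
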